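/-
Copyright (c) 2026 the pub-hodgecm-mathlib formalisation cell (harness21).  Prover seat hodgecm-mathlib-LH4-p17 (g3) (Track A «FOUR-FRAME» free hand routed to L1 by the
CHAIR VALVE; K1a desk K2Liu-p01 (g11) «p17: PEN» 2026-09-05T02:45:30Z and DESK WORD #15 (3) 02:48:02Z «PLAN (2) GO»; consumer of record ★ p864639
`K2LiuKindOneSingularGaussianDictionary.hgauss_of_cornerReading` (letter (a) `htw`) and every ARCH-CONT instantiation of ★ p864004), Track B «K2-LIT»,
#184♮ = hLiu418 = `stmt-HodgeConjecture-24832`.  THEOREMS ONLY (no `def`, no instance, no notation, no named-fact hypothesis, no `sorry`, default heartbeats).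
-/
import Summits.HodgeConjecture.HodgeConjecture.Theorems.K2LiuHermTwoGammaDefs                 -- ★ `hermTwo` (the chart of ★ p864004's index datum `a·hermTwo(t,0,0)·aᴴ`)
import Summits.HodgeConjecture.HodgeConjecture.Theorems.K2LiuIncoherentRankOneSignJunction    -- ★ p863951 (this seat): CM-embedding algebra + the frame vocabulary
import HarnessLib

/-!
# Crux `HLiu418`, socket #41 K1-a♮ (L2-dock) × block D (ARCH-CONT) — `K2LiuKindOneSingularCornerIndexDatum`: IN THE SHIMURA FRAME OF RECORD THE FRAMED CORNER
# INDEX IS `single b b (i·sgn(t_b)·τ_w σ) = ± a_b·hermTwo(w(σ),0,0)·a_bᴴ` — ★ p864004's datum `(a, t) = (a_b, w(σ))`, hence the READING LETTER (a) `tw X w' = w'(σc X)`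

Cell `hodgecm-mathlib`, crux item hLiu418 = `stmt-HodgeConjecture-24832`, route `HCCMUnconditional`; squad K2 ∕ K2Liu (L1).  Lane `--supports stmt-HodgeConjecture-24832 --as helper`
(count-neutral).  CLOSES NO SOCKET.

THE SLOT.  ★ p864639 `hgauss_of_cornerReading` takes BY VALUE the per-place Gaussian variable `tw X w'` of the continued archimedean letter at the corner index, with the
reading (a) `htw : ct·w'(σc X) ≤ tw X w'`.  The continued local letter is ★ p864004 `exists_archLetters_scalarType_explicit{_neg} (k) (hdet : ‖a.det‖ = 1) (ht : 0 < t)` at the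
index datum `± a·hermTwo(t,0,0)·aᴴ`, whose Gaussian parameter is `t`; the index it must match is the FRAMED index of ★ p863743's character reading,
`hhidx : hidx w = (−2)•((T w)₂₂ · S.map σ_w · (Tinv w)₁₁)`, at the corner `S = single b b σ`.  For the tube frame OF RECORD — ★ `exists_tubeFrame_arch₄` (x) = ★ `exists_tubeFrame₄`:
`T = (D D; C −C)`, `Tinv = ½(D⁻¹ −C⁻¹; D⁻¹ C⁻¹)` with `D = diag √(|t_k|∕2)`, `C = diag (i·sgn t_k·√(|t_k|∕2))` — one has `(T)₂₂ = −C`, `(Tinv)₁₁ = ½D⁻¹`, so the framed corner index is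
`−2·(−C)·single b b (τ_w σ)·½D⁻¹ = single b b (i·sgn(t_b)·τ_w σ)` (§2 `framedIndex_single_of_shimuraFrame`).  For `σ` purely imaginary (`c σ = −σ`, the corner values of record,
★ p863951 §1) the scalar `i·sgn(t_b)·τ_w σ = −sgn(t_b)·Im τ_w σ` is REAL of modulus `‖τ_w σ‖ = w(σ)`, and `single b b (±y) = ± a_b·hermTwo(y,0,0)·a_bᴴ` (`y > 0`) for the coordinate
frame `a_0 = 1`, `a_1 = (0 1; 1 0)` (`‖det a_b‖ = 1`).  HENCE THE DATUM: `a := a_b` (depends on `b` only), `t := w(σ)`, twin (`explicit` ∕ `explicit_neg`) chosen by the sign of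
`−sgn(t_b)·Im τ_w σ` (never zero for `σ ≠ 0`) — §3 `exists_cornerDatum_at_place`; and the reading letter (a) holds with EQUALITY at `tw X w' := w'(σc X)`, `ct := 1` (§3 `htw_of_htw_eq`,
with the `κ`-scaled variant `htw_of_htw_eq_mul` for a corner entry `u·σc X`).
THIS FILE (hypothesis-first; pure matrix algebra, the frame letters `hTdef hTinvdef` BY VALUE in ★ `exists_tubeFrame₄`'s bytes with `t : Fin 2 → ℝ` by value — consumers holding
★ `exists_tubeFrame_arch₄` (x) instantiate `t := fun k => (w.1.embedding (dV (e.symm k).1 * dW (e.symm k).2)).re`):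
* §1 `diagonal_mul_single_mul_diagonal`, `hermTwo_eq_single`, `swap_mul_hermTwo_mul_eq_single`, `norm_det_swap`, `exists_frame_single` (`∃ a_b, ‖det a_b‖ = 1 ∧ ∀ y,
  a_b·hermTwo(y,0,0)·a_bᴴ = single b b y`), `exists_datum_of_im_eq_zero` (real `z`: `single b b z = ± a_b·hermTwo(‖z‖,0,0)·a_bᴴ` by the sign of `z.re`), scalar letters
  `norm_I_mul_sign_mul`, `im_I_mul_ofReal_mul`, `re_I_mul_ofReal_mul`.
* §2 **`framedIndex_single_of_shimuraFrame`**, **`exists_cornerDatum_of_shimuraFrame`** (purely imaginary `x`).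
* §3 **`exists_cornerDatum_at_place`** (at a complex place, `c σ = −σ`: datum `(a_b, w σ)`, sign dichotomy for `σ ≠ 0`), **`htw_of_htw_eq`**, **`htw_of_htw_eq_mul`** (★ p864639's (a) bytes).
RELATION TO THE SIGNATURE ROAD (LEAD F0P6-plan (g16) BATCH #267 (2) (i), K2E3-p14 (g10) `K2LiuRankOneFramedCornerIndexLetters`; ★ p864788 `hW1_scalarType_rankOne`'s `hsd hdet0 hne`):
the explicit form `single b b (i·sgn(t_b)·τ_w σ)` with a REAL scalar gives hermitian ∕ `det = 0` ∕ `≠ 0` ∕ semidefinite-of-the-sign at once; ★ p864788's spectral datum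
(`exists_unitaryFrame_of_posSemidef_rankOne`) and this file's coordinate datum `(a_b, w σ)` present the SAME index, the latter with the Gaussian variable `t = w(σ)` explicit (what
★ p864639's by-value `tw` needs).
HONEST LABEL.  Count-neutral helper (matrix algebra); which `σ ∈ L` sits at the framed corner (`σc X` up to the gram unit of ★ (A)'s presentation) is the consumer's letter; `HC_CM` is
proved only modulo the 7 printed citations (2 remaining named inputs: hLiu418 = `stmt-HodgeConjecture-24832`, h413 = `stmt-HodgeConjecture-24833`) until rung 0 closes.

## References
* [Shimura1997] G. Shimura, *Euler Products and Eisenstein Series*, CBMS 93 (1997): §6.5 (the tube frame), §18.1 (18.4) (framed Fourier index).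
* [Shimura1982] G. Shimura, *Confluent hypergeometric functions on tube domains*, Math. Ann. 260 (1982): §4 Thm. 4.2 (the Gaussian parameter of the confluent factor).
* [KudlaRallis1994] S. Kudla, S. Rallis, *A regularized Siegel–Weil formula: the first term identity*, Ann. of Math. 140 (1994): §2 (2.10)–(2.12).
-/

set_option autoImplicit false
set_option linter.dupNamespace false -- the mandated namespace repeats `HodgeConjecture.HodgeConjecture`

noncomputable section

open scoped Matrix ComplexConjugate
open Complex Matrix NumberField NumberField.InfinitePlace IsDedekindDomain
open Literature.NumberTheory.Automorphic Literature.NumberTheory.Automorphic.UnitaryGroup Literature.NumberTheory.GaloisRepresentations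
open Literature.NumberTheory.GelbartRogawski1991 Literature.NumberTheory.GelbartRogawski1991.GRConstruction

namespace Summit.HodgeConjecture.HodgeConjecture.Cruxes.HLiu418.K2LiuKindOneSingularCornerIndexDatum

open K2LiuSiegelUnipotentFourierDefs
open K2LiuHermTwoGammaDefs (hermTwo)
open K2LiuIncoherentRankOneSignJunction (re_embedding_eq_zero_of_complexConj_eq_neg)

/-! ## §1 Matrix algebra: rank-one diagonal indices, ★ p864004's chart, and the framed scalar -/

section Algebra

/-- `diagonal c · single b b x · diagonal d′ = single b b (c b · x · d′ b)`. [cite: Shimura1997, §18.1 (18.4)] -/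
theorem diagonal_mul_single_mul_diagonal (c d' : Fin 2 → ℂ) (b : Fin 2) (x : ℂ) :
    diagonal c * Matrix.single b b x * diagonal d' = Matrix.single b b (c b * x * d' b) := by
  ext i j
  rw [mul_diagonal, diagonal_mul, Matrix.single_apply, Matrix.single_apply]
  split_ifs with h
  · obtain ⟨rfl, rfl⟩ := h
    rfl
  · rw [mul_zero, zero_mul]

/-- ★ p864004's chart at `(y, 0, 0)` is the rank-one diagonal matrix `single 0 0 y` (the `single`-currency twin of ★ p864788 `hermTwo_eq_diagonal`). [cite: Shimura1982, §4 Thm. 4.2] -/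
theorem hermTwo_eq_single (y : ℝ) : hermTwo (y, 0, 0) = Matrix.single 0 0 (y : ℂ) := by
  ext i j
  fin_cases i <;> fin_cases j <;> simp [hermTwo]

/-- Conjugating the chart by the coordinate swap moves the entry to the corner `(1, 1)`: `(0 1; 1 0)·hermTwo(y,0,0)·(0 1; 1 0)ᴴ = single 1 1 y` (the `single`-currency twin of
★ p864788 `flip_mul_hermTwo_mul_flip`). [cite: Shimura1982, §4] -/
theorem swap_mul_hermTwo_mul_eq_single (y : ℝ) :
    !![(0 : ℂ), 1; 1, 0] * hermTwo (y, 0, 0) * (!![(0 : ℂ), 1; 1, 0])ᴴ = Matrix.single 1 1 (y : ℂ) := by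
  ext i j
  fin_cases i <;> fin_cases j <;> simp [hermTwo, Matrix.mul_apply, Fin.sum_univ_two, conjTranspose_apply]

/-- The coordinate swap has `‖det‖ = 1` (★ p864004's binder `hdet`). [folklore] -/
theorem norm_det_swap : ‖(!![(0 : ℂ), 1; 1, 0] : Matrix (Fin 2) (Fin 2) ℂ).det‖ = 1 := by
  simp [Matrix.det_fin_two]

/-- **THE COORDINATE FRAME `a_b`.**  For each `b : Fin 2` there is `a_b` with `‖det a_b‖ = 1` and `a_b · hermTwo(y,0,0) · a_bᴴ = single b b y` for every real `y`
(`a_0 = 1`, `a_1 =` the swap). [cite: Shimura1982, §4 Thm. 4.2] -/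
theorem exists_frame_single (b : Fin 2) :
    ∃ a : Matrix (Fin 2) (Fin 2) ℂ, ‖a.det‖ = 1 ∧ ∀ y : ℝ, a * hermTwo (y, 0, 0) * aᴴ = Matrix.single b b (y : ℂ) := by
  fin_cases b
  · exact ⟨1, by rw [det_one, norm_one], fun y => by rw [one_mul, conjTranspose_one, mul_one, hermTwo_eq_single]; rfl⟩
  · exact ⟨!![(0 : ℂ), 1; 1, 0], norm_det_swap, fun y => swap_mul_hermTwo_mul_eq_single y⟩

/-- **THE DATUM OF A REAL RANK-ONE DIAGONAL INDEX.**  For real `z` (`z.im = 0`): `single b b z = a_b·hermTwo(‖z‖,0,0)·a_bᴴ` if `0 < z.re` (★ p864004 `explicit`, `t := ‖z‖`), and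
`single b b z = −(a_b·hermTwo(‖z‖,0,0)·a_bᴴ)` if `z.re < 0` (★ p864004 `explicit_neg`, `t := ‖z‖`). [cite: Shimura1982, §4 Thm. 4.2] -/
theorem exists_datum_of_im_eq_zero (b : Fin 2) :
    ∃ a : Matrix (Fin 2) (Fin 2) ℂ, ‖a.det‖ = 1 ∧ ∀ z : ℂ, z.im = 0 →
      (0 < z.re → Matrix.single b b z = a * hermTwo (‖z‖, 0, 0) * aᴴ) ∧
      (z.re < 0 → Matrix.single b b z = -(a * hermTwo (‖z‖, 0, 0) * aᴴ)) := by
  obtain ⟨a, ha, hay⟩ := exists_frame_single b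
  refine ⟨a, ha, fun z hz => ⟨fun hpos => ?_, fun hneg => ?_⟩⟩
  · have hzre : ((‖z‖ : ℝ) : ℂ) = z := by
      rw [← Complex.abs_re_eq_norm.2 hz, abs_of_pos hpos]
      exact Complex.ext (by simp) (by simp [hz])
    rw [hay, hzre]
  · have hzre : ((‖z‖ : ℝ) : ℂ) = -z := by
      rw [← Complex.abs_re_eq_norm.2 hz, abs_of_neg hneg]
      exact Complex.ext (by simp) (by simp [hz])
    rw [hay, hzre, Matrix.single_neg, neg_neg]

/-- `‖i · sgn(r) · x‖ = ‖x‖` for `r ≠ 0`. [folklore] -/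
theorem norm_I_mul_sign_mul {r : ℝ} (hr : r ≠ 0) (x : ℂ) : ‖I * ((r / |r| : ℝ) : ℂ) * x‖ = ‖x‖ := by
  rw [norm_mul, norm_mul, Complex.norm_I, one_mul, Complex.norm_real, Real.norm_eq_abs, abs_div, abs_abs, div_self (abs_ne_zero.2 hr), one_mul]

/-- `Im (i · s · x) = s · Re x` for real `s`. [folklore] -/
theorem im_I_mul_ofReal_mul (s : ℝ) (x : ℂ) : (I * (s : ℂ) * x).im = s * x.re := by
  rw [mul_assoc, Complex.I_mul_im, Complex.re_ofReal_mul]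

/-- `Re (i · s · x) = −(s · Im x)` for real `s`. [folklore] -/
theorem re_I_mul_ofReal_mul (s : ℝ) (x : ℂ) : (I * (s : ℂ) * x).re = -(s * x.im) := by
  rw [mul_assoc, Complex.I_mul_re, Complex.im_ofReal_mul]

end Algebra

/-! ## §2 The framed corner index in the Shimura frame of record (★ `exists_tubeFrame₄` ∕ ★ `exists_tubeFrame_arch₄` (x), letters `hTdef hTinvdef` BY VALUE) -/

section Frame

/-- **THE FRAMED CORNER INDEX.**  In the Shimura frame `T = (D D; C −C)`, `Tinv = ½(D⁻¹ −C⁻¹; D⁻¹ C⁻¹)` (`D = diag √(|t|∕2)`, `C = diag(i·sgn t·√(|t|∕2))`, the explicit letters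
`hTdef hTinvdef` of ★ `exists_tubeFrame₄`), ★ p863743's framed index `−2·(T)₂₂·S·(Tinv)₁₁` of the rank-one corner index `S = single b b x` is `single b b (i·sgn(t_b)·x)`.
[cite: Shimura1997, §6.5, §18.1 (18.4)] -/
theorem framedIndex_single_of_shimuraFrame (T Tinv : Matrix (Fin 2 ⊕ Fin 2) (Fin 2 ⊕ Fin 2) ℂ) (t : Fin 2 → ℝ) (ht : ∀ i, t i ≠ 0)
    (hTdef : T = fromBlocks (diagonal (fun i => (Real.sqrt (|t i| / 2) : ℂ))) (diagonal (fun i => (Real.sqrt (|t i| / 2) : ℂ)))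
          (diagonal (fun i => I * (((t i / |t i|) * Real.sqrt (|t i| / 2) : ℝ) : ℂ))) (-diagonal (fun i => I * (((t i / |t i|) * Real.sqrt (|t i| / 2) : ℝ) : ℂ))))
    (hTinvdef : Tinv = fromBlocks (diagonal (fun i => (((Real.sqrt (|t i| / 2))⁻¹ / 2 : ℝ) : ℂ))) (-diagonal (fun i => I * (((Real.sqrt (|t i| / 2))⁻¹ * (t i / |t i|) / 2 : ℝ) : ℂ)))
          (diagonal (fun i => (((Real.sqrt (|t i| / 2))⁻¹ / 2 : ℝ) : ℂ))) (diagonal (fun i => I * (((Real.sqrt (|t i| / 2))⁻¹ * (t i / |t i|) / 2 : ℝ) : ℂ))))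
    (b : Fin 2) (x : ℂ) :
    (-2 : ℂ) • (T.toBlocks₂₂ * Matrix.single b b x * Tinv.toBlocks₁₁) = Matrix.single b b (I * ((t b / |t b| : ℝ) : ℂ) * x) := by
  subst hTdef hTinvdef
  simp only [toBlocks_fromBlocks₂₂, toBlocks_fromBlocks₁₁, diagonal_neg, diagonal_mul_single_mul_diagonal, smul_single, smul_eq_mul]
  congr 1
  have hr : ((Real.sqrt (|t b| / 2) : ℝ) : ℂ) ≠ 0 := by exact_mod_cast (Real.sqrt_pos.2 (div_pos (abs_pos.2 (ht b)) two_pos)).ne'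
  rw [Complex.ofReal_mul, Complex.ofReal_div ((Real.sqrt (|t b| / 2))⁻¹) 2, Complex.ofReal_inv, Complex.ofReal_ofNat]
  calc (-2 : ℂ) * (-(I * (((t b / |t b| : ℝ) : ℂ) * ((Real.sqrt (|t b| / 2) : ℝ) : ℂ))) * x * ((((Real.sqrt (|t b| / 2) : ℝ) : ℂ))⁻¹ / 2))
      = I * ((t b / |t b| : ℝ) : ℂ) * x * (((Real.sqrt (|t b| / 2) : ℝ) : ℂ) * (((Real.sqrt (|t b| / 2) : ℝ) : ℂ))⁻¹) := by ring
    _ = I * ((t b / |t b| : ℝ) : ℂ) * x := by rw [mul_inv_cancel₀ hr, mul_one]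

/-- **THE CORNER DATUM IN THE SHIMURA FRAME (purely imaginary corner value).**  For `x` with `Re x = 0` the framed corner index `−2·(T)₂₂·single b b x·(Tinv)₁₁` is
`a_b·hermTwo(‖x‖,0,0)·a_bᴴ` when `0 < −sgn(t_b)·Im x` and `−(a_b·hermTwo(‖x‖,0,0)·a_bᴴ)` when `−sgn(t_b)·Im x < 0` — ★ p864004's datum `(a, t) := (a_b, ‖x‖)` with `‖det a_b‖ = 1`,
the twin decided by the sign. [cite: Shimura1997, §18.1 (18.4)] [cite: Shimura1982, §4 Thm. 4.2] -/
theorem exists_cornerDatum_of_shimuraFrame (T Tinv : Matrix (Fin 2 ⊕ Fin 2) (Fin 2 ⊕ Fin 2) ℂ) (t : Fin 2 → ℝ) (ht : ∀ i, t i ≠ 0)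
    (hTdef : T = fromBlocks (diagonal (fun i => (Real.sqrt (|t i| / 2) : ℂ))) (diagonal (fun i => (Real.sqrt (|t i| / 2) : ℂ)))
          (diagonal (fun i => I * (((t i / |t i|) * Real.sqrt (|t i| / 2) : ℝ) : ℂ))) (-diagonal (fun i => I * (((t i / |t i|) * Real.sqrt (|t i| / 2) : ℝ) : ℂ))))
    (hTinvdef : Tinv = fromBlocks (diagonal (fun i => (((Real.sqrt (|t i| / 2))⁻¹ / 2 : ℝ) : ℂ))) (-diagonal (fun i => I * (((Real.sqrt (|t i| / 2))⁻¹ * (t i / |t i|) / 2 : ℝ) : ℂ)))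
          (diagonal (fun i => (((Real.sqrt (|t i| / 2))⁻¹ / 2 : ℝ) : ℂ))) (diagonal (fun i => I * (((Real.sqrt (|t i| / 2))⁻¹ * (t i / |t i|) / 2 : ℝ) : ℂ))))
    (b : Fin 2) :
    ∃ a : Matrix (Fin 2) (Fin 2) ℂ, ‖a.det‖ = 1 ∧ ∀ x : ℂ, x.re = 0 →
      (0 < -((t b / |t b|) * x.im) → (-2 : ℂ) • (T.toBlocks₂₂ * Matrix.single b b x * Tinv.toBlocks₁₁) = a * hermTwo (‖x‖, 0, 0) * aᴴ) ∧
      (-((t b / |t b|) * x.im) < 0 → (-2 : ℂ) • (T.toBlocks₂₂ * Matrix.single b b x * Tinv.toBlocks₁₁) = -(a * hermTwo (‖x‖, 0, 0) * aᴴ)) := by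
  obtain ⟨a, ha, hz⟩ := exists_datum_of_im_eq_zero b
  refine ⟨a, ha, fun x hx => ?_⟩
  have him : (I * ((t b / |t b| : ℝ) : ℂ) * x).im = 0 := by rw [im_I_mul_ofReal_mul, hx, mul_zero]
  have hre : (I * ((t b / |t b| : ℝ) : ℂ) * x).re = -((t b / |t b|) * x.im) := re_I_mul_ofReal_mul _ _
  rw [framedIndex_single_of_shimuraFrame T Tinv t ht hTdef hTinvdef b x, ← norm_I_mul_sign_mul (ht b) x]
  exact ⟨fun hpos => (hz _ him).1 (by rw [hre]; exact hpos), fun hneg => (hz _ him).2 (by rw [hre]; exact hneg)⟩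

end Frame

/-! ## §3 At a complex place of the CM field: the datum `(a_b, w σ)` for a purely imaginary corner value, and ★ p864639's letter (a) -/

section Place

variable {L : Type} [Field L] [NumberField L] [IsCMField L]

/-- **THE CORNER DATUM AT A COMPLEX PLACE.**  Frame letters `hTdef hTinvdef` of ★ `exists_tubeFrame_arch₄` (x) at `w` BY VALUE (`t k := Re σ_w(dV·dW)` there).  For every purely
imaginary `σ ∈ L` (`c σ = −σ` — the corner values of record, ★ p863951 §1): ★ p863743's framed corner index `−2·(T)₂₂·(single b b σ).map σ_w·(Tinv)₁₁` equals
`a_b·hermTwo(w σ,0,0)·a_bᴴ` when `0 < −sgn(t_b)·Im σ_w σ`, equals `−(a_b·hermTwo(w σ,0,0)·a_bᴴ)` when that number is negative, and for `σ ≠ 0` one of the two happens.  So the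
ARCH-CONT datum at `w` is `(a, t) := (a_b, w σ)` — `a_b` depending on `b` alone, `‖det a_b‖ = 1`, Gaussian variable `t = w(σ)`. [cite: Shimura1997, §18.1 (18.4)] [cite: Shimura1982, §4 Thm. 4.2] -/
theorem exists_cornerDatum_at_place (w : {w : InfinitePlace L // w.IsComplex}) (T Tinv : Matrix (Fin 2 ⊕ Fin 2) (Fin 2 ⊕ Fin 2) ℂ) (t : Fin 2 → ℝ) (ht : ∀ i, t i ≠ 0)
    (hTdef : T = fromBlocks (diagonal (fun i => (Real.sqrt (|t i| / 2) : ℂ))) (diagonal (fun i => (Real.sqrt (|t i| / 2) : ℂ)))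
          (diagonal (fun i => I * (((t i / |t i|) * Real.sqrt (|t i| / 2) : ℝ) : ℂ))) (-diagonal (fun i => I * (((t i / |t i|) * Real.sqrt (|t i| / 2) : ℝ) : ℂ))))
    (hTinvdef : Tinv = fromBlocks (diagonal (fun i => (((Real.sqrt (|t i| / 2))⁻¹ / 2 : ℝ) : ℂ))) (-diagonal (fun i => I * (((Real.sqrt (|t i| / 2))⁻¹ * (t i / |t i|) / 2 : ℝ) : ℂ)))
          (diagonal (fun i => (((Real.sqrt (|t i| / 2))⁻¹ / 2 : ℝ) : ℂ))) (diagonal (fun i => I * (((Real.sqrt (|t i| / 2))⁻¹ * (t i / |t i|) / 2 : ℝ) : ℂ))))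
    (b : Fin 2) :
    ∃ a : Matrix (Fin 2) (Fin 2) ℂ, ‖a.det‖ = 1 ∧ ∀ σ : L, IsCMField.complexConj L σ = -σ →
      (0 < -((t b / |t b|) * (w.1.embedding σ).im) →
        (-2 : ℂ) • (T.toBlocks₂₂ * (Matrix.single b b σ).map w.1.embedding * Tinv.toBlocks₁₁) = a * hermTwo (w.1 σ, 0, 0) * aᴴ) ∧
      (-((t b / |t b|) * (w.1.embedding σ).im) < 0 →
        (-2 : ℂ) • (T.toBlocks₂₂ * (Matrix.single b b σ).map w.1.embedding * Tinv.toBlocks₁₁) = -(a * hermTwo (w.1 σ, 0, 0) * aᴴ)) ∧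
      (σ ≠ 0 → 0 < -((t b / |t b|) * (w.1.embedding σ).im) ∨ -((t b / |t b|) * (w.1.embedding σ).im) < 0) := by
  obtain ⟨a, ha, hx⟩ := exists_cornerDatum_of_shimuraFrame T Tinv t ht hTdef hTinvdef b
  refine ⟨a, ha, fun σ hσ => ?_⟩
  have hre : (w.1.embedding σ).re = 0 := re_embedding_eq_zero_of_complexConj_eq_neg w.1.embedding hσ
  rw [Matrix.map_single, ← norm_embedding_eq w.1 σ]
  refine ⟨(hx _ hre).1, (hx _ hre).2, fun hσ0 => ?_⟩
  rcases lt_trichotomy 0 (-((t b / |t b|) * (w.1.embedding σ).im)) with h | h | h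
  · exact Or.inl h
  · exfalso
    have him : (w.1.embedding σ).im ≠ 0 := fun him =>
      ((map_ne_zero w.1.embedding).2 hσ0) (Complex.ext (by rw [hre, Complex.zero_re]) (by rw [him, Complex.zero_im]))
    exact mul_ne_zero (div_ne_zero (ht b) (abs_ne_zero.2 (ht b))) him (neg_eq_zero.1 h.symm)
  · exact Or.inr h

variable (L) {N M : ℕ} (e : Fin N × Fin M ≃ Fin 2)
  (dV : Fin N → L) (hdV : ∀ i, IsCMField.complexConj L (dV i) = dV i)
  (dW : Fin M → L) (hdW : ∀ i, IsCMField.complexConj L (dW i) = dW i)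

/-- **★ p864639's LETTER (a) FROM THE DATUM, `ct := 1`.**  When the (m0) producer's per-place Gaussian variable is the datum's — `tw X w' = w'(σc X)` (§3 `exists_cornerDatum_at_place`:
`t := w(σ)`) — the reading (a) `ct·w'(σc X) ≤ tw X w'` holds with `ct := 1` (with equality). [cite: KudlaRallis1994, §2 (2.10)–(2.12)] [cite: Shimura1982, §4 Thm. 4.2] -/
theorem htw_of_htw_eq (Tinf : Finset (InfinitePlace L))
    (σc : skewMatrices ((IsCMField.complexConj L : L ≃ₐ[Fp L] L) : L →+* L) ((gramR L e dV hdV dW hdW).map (algebraMap (Fp L) L)) → L)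
    (tw : skewMatrices ((IsCMField.complexConj L : L ≃ₐ[Fp L] L) : L →+* L) ((gramR L e dV hdV dW hdW).map (algebraMap (Fp L) L)) → InfinitePlace L → ℝ)
    (htw_eq : ∀ X : skewMatrices ((IsCMField.complexConj L : L ≃ₐ[Fp L] L) : L →+* L) ((gramR L e dV hdV dW hdW).map (algebraMap (Fp L) L)),
      (X : Matrix (Fin 2) (Fin 2) L) ≠ 0 → (X : Matrix (Fin 2) (Fin 2) L).det = 0 → ∀ w' ∈ Tinf, tw X w' = w' (σc X)) :
    ∀ X : skewMatrices ((IsCMField.complexConj L : L ≃ₐ[Fp L] L) : L →+* L) ((gramR L e dV hdV dW hdW).map (algebraMap (Fp L) L)),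
      (X : Matrix (Fin 2) (Fin 2) L) ≠ 0 → (X : Matrix (Fin 2) (Fin 2) L).det = 0 → ∀ w' ∈ Tinf, (1 : ℝ) * w' (σc X) ≤ tw X w' :=
  fun X hX hdet w' hw' => by rw [one_mul, htw_eq X hX hdet w' hw']

/-- **★ p864639's LETTER (a), SCALED.**  When the framed corner entry is `u_{w'}·σc X` for place-dependent units read as `κ w' = w'(u)` with a uniform floor `ct ≤ κ w'` on `Tinf`
(`0 < ct`), and `tw X w' = κ w'·w'(σc X)`, the reading (a) `ct·w'(σc X) ≤ tw X w'` holds. [cite: KudlaRallis1994, §2 (2.10)–(2.12)] [cite: Shimura1982, §4 Thm. 4.2] -/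
theorem htw_of_htw_eq_mul (Tinf : Finset (InfinitePlace L))
    (σc : skewMatrices ((IsCMField.complexConj L : L ≃ₐ[Fp L] L) : L →+* L) ((gramR L e dV hdV dW hdW).map (algebraMap (Fp L) L)) → L)
    (tw : skewMatrices ((IsCMField.complexConj L : L ≃ₐ[Fp L] L) : L →+* L) ((gramR L e dV hdV dW hdW).map (algebraMap (Fp L) L)) → InfinitePlace L → ℝ)
    (κ : InfinitePlace L → ℝ) {ct : ℝ} (hκ : ∀ w' ∈ Tinf, ct ≤ κ w')
    (htw_eq : ∀ X : skewMatrices ((IsCMField.complexConj L : L ≃ₐ[Fp L] L) : L →+* L) ((gramR L e dV hdV dW hdW).map (algebraMap (Fp L) L)),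
      (X : Matrix (Fin 2) (Fin 2) L) ≠ 0 → (X : Matrix (Fin 2) (Fin 2) L).det = 0 → ∀ w' ∈ Tinf, tw X w' = κ w' * w' (σc X)) :
    ∀ X : skewMatrices ((IsCMField.complexConj L : L ≃ₐ[Fp L] L) : L →+* L) ((gramR L e dV hdV dW hdW).map (algebraMap (Fp L) L)),
      (X : Matrix (Fin 2) (Fin 2) L) ≠ 0 → (X : Matrix (Fin 2) (Fin 2) L).det = 0 → ∀ w' ∈ Tinf, ct * w' (σc X) ≤ tw X w' :=
  fun X hX hdet w' hw' => by
    rw [htw_eq X hX hdet w' hw']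
    exact mul_le_mul_of_nonneg_right (hκ w' hw') (apply_nonneg w' (σc X))

end Place

end Summit.HodgeConjecture.HodgeConjecture.Cruxes.HLiu418.K2LiuKindOneSingularCornerIndexDatum

end
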